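import Summits.Ventures.HSemireg.WedgeWeilCarrier

/-!
# Venture HSemireg — the two ADAPTED BLOCKS `U₊ = ⟨ℓ_{n+j}, m_j⟩`, `U₋ = ⟨ℓ_j, m_{n+j}⟩` of a Weil frame as subspaces, and the carrier
# Weil vectors `w₊`, `w₋` as TOP FORMS INSIDE them (`ω₊ ∈ Λ^{2n} U₊`, `ω₋ ∈ Λ^{2n} U₋`, `Λ(ι) ω_± = w_±`)

HONEST FRAMING. Pure linear algebra (seat p4 of the computation cell `pub-hsemireg`): for a `K`-space `V` with a basis `bV` indexed by
`Fin (2n + 2n)` (bridge letters `ℓ_a = bV a`, `m_a = bV (2n + a)` of `WedgeCarrierDictionary.lean`), the blocks `Uup n bV = span{ℓ_{n+j}, m_j}`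
and `Ulow n bV = span{ℓ_j, m_{n+j}}` are complementary (`isCompl_Uup_Ulow`) of dimension `2n` each, `L = Lsp bV` splits as `Lup ⊔ Llow` with
`Lup ≤ Uup`, `Llow ≤ Ulow` of dimension `n` each, and the carrier Weil vectors of `WedgeWeilCarrier.lean` are images of top forms of the blocks:
`ExteriorAlgebra.map Uup.subtype omegaUp = wUp bV n`, `… omegaLow = wLow bV n`, `omegaUp ∈ Λ^{2n} Uup`, `≠ 0`.  This is exactly the BY-VALUE
splitting data of p4 gen 2's `ContractionRankPointPairBox.lean`, produced from an adapted Weil frame — used by `ContractionRankWeilPure.lean`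
(a pure four-term Weil-frame class is a box).  On a Weil-type abelian variety the blocks are the `K`-eigenspaces `H¹_±` (th-7, FORMULA-N PART B
§L); that dictionary is NOT asserted here.  Nothing here is a claim about any variety; nothing here says that HC / HC_CM / HC_AV holds.
Everything PROVED; no named fact.  References: [BourbakiAlgebre1a3] Ch. II §1 no. 11, Ch. III §7 no. 1.
-/

noncomputable section

open Module


namespace Summit.Ventures.HSemireg

namespace WeilCarrier

open Summit.Ventures.HSemireg.WedgeBridge
open CliffordAlgebra (contractLeft)
open ExteriorAlgebra (ι)

variable {K : Type*} [Field K] {n : ℕ} {V : Type*} [AddCommGroup V] [Module K V]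
  (bV : Basis (Fin (n + n + (n + n))) K V)

/-! ### 1. The two adapted blocks `U₊ = ⟨ℓ_{n+j}, m_j⟩`, `U₋ = ⟨ℓ_j, m_{n+j}⟩` as spans of sub-families of the basis -/

/-- indices of the `U₊` block: `ℓ_{n+j}` and `m_j`. -/
def upIdx (n : ℕ) : Fin n ⊕ Fin n → Fin (n + n + (n + n)) :=
  Sum.elim (fun j => Fin.castAdd (n + n) (Fin.natAdd n j)) (fun j => Fin.natAdd (n + n) (Fin.castAdd n j))

/-- indices of the `U₋` block: `ℓ_j` and `m_{n+j}`. -/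
def lowIdx (n : ℕ) : Fin n ⊕ Fin n → Fin (n + n + (n + n)) :=
  Sum.elim (fun j => Fin.castAdd (n + n) (Fin.castAdd n j)) (fun j => Fin.natAdd (n + n) (Fin.natAdd n j))

/-- values of the `U₊` indices. -/
lemma upIdx_val (i : Fin n ⊕ Fin n) :
    ((upIdx n i : Fin (n + n + (n + n))) : ℕ) = Sum.elim (fun j : Fin n => n + (j : ℕ)) (fun j : Fin n => n + n + (j : ℕ)) i := by
  rcases i with j | j
  · rfl
  · rfl

/-- values of the `U₋` indices. -/
lemma lowIdx_val (i : Fin n ⊕ Fin n) :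
    ((lowIdx n i : Fin (n + n + (n + n))) : ℕ) = Sum.elim (fun j : Fin n => (j : ℕ)) (fun j : Fin n => n + n + (n + (j : ℕ))) i := by
  rcases i with j | j
  · rfl
  · rfl

/-- `upIdx` is injective. -/
lemma upIdx_injective : Function.Injective (upIdx n) := by
  intro i i' h
  have hv := congrArg (fun x : Fin (n + n + (n + n)) => (x : ℕ)) h
  simp only [upIdx_val] at hv
  rcases i with j | j <;> rcases i' with j' | j' <;> simp only [Sum.elim_inl, Sum.elim_inr] at hv
  · exact congrArg Sum.inl (Fin.ext (by omega))
  · exfalso; have := j.2; omega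
  · exfalso; have := j'.2; omega
  · exact congrArg Sum.inr (Fin.ext (by omega))

/-- `lowIdx` is injective. -/
lemma lowIdx_injective : Function.Injective (lowIdx n) := by
  intro i i' h
  have hv := congrArg (fun x : Fin (n + n + (n + n)) => (x : ℕ)) h
  simp only [lowIdx_val] at hv
  rcases i with j | j <;> rcases i' with j' | j' <;> simp only [Sum.elim_inl, Sum.elim_inr] at hv
  · exact congrArg Sum.inl (Fin.ext (by omega))
  · exfalso; have := j.2; omega
  · exfalso; have := j'.2; omega
  · exact congrArg Sum.inr (Fin.ext (by omega))

/-- the two index blocks are disjoint. -/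
lemma disjoint_range_upIdx_lowIdx : Disjoint (Set.range (upIdx n)) (Set.range (lowIdx n)) := by
  rw [Set.disjoint_left]
  rintro _ ⟨i, rfl⟩ ⟨i', h⟩
  have hv := congrArg (fun x : Fin (n + n + (n + n)) => (x : ℕ)) h
  simp only [upIdx_val, lowIdx_val] at hv
  rcases i with j | j <;> rcases i' with j' | j' <;> simp only [Sum.elim_inl, Sum.elim_inr] at hv <;>
    (have := j.2; have := j'.2; omega)

/-- the two index blocks cover all indices. -/
lemma range_upIdx_union_lowIdx : Set.range (upIdx n) ∪ Set.range (lowIdx n) = Set.univ := by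
  ext x
  simp only [Set.mem_union, Set.mem_range, Set.mem_univ, iff_true]
  have hx := x.2
  by_cases h1 : (x : ℕ) < n
  · exact Or.inr ⟨Sum.inl ⟨x, h1⟩, Fin.ext (by simp [lowIdx_val])⟩
  by_cases h2 : (x : ℕ) < n + n
  · exact Or.inl ⟨Sum.inl ⟨x - n, by omega⟩, Fin.ext (by simp [upIdx_val]; omega)⟩
  by_cases h3 : (x : ℕ) < n + n + n
  · exact Or.inl ⟨Sum.inr ⟨x - (n + n), by omega⟩, Fin.ext (by simp [upIdx_val]; omega)⟩
  · exact Or.inr ⟨Sum.inr ⟨x - (n + n + n), by omega⟩, Fin.ext (by simp [lowIdx_val]; omega)⟩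

/-- **the block `U₊ = ⟨ℓ_{n+j}, m_j⟩`.** [cite: BourbakiAlgebre1a3, Ch. III §7 no. 1] -/
def Uup (n : ℕ) (bV : Basis (Fin (n + n + (n + n))) K V) : Submodule K V :=
  Submodule.span K (Set.range (bV ∘ upIdx n))

/-- **the block `U₋ = ⟨ℓ_j, m_{n+j}⟩`.** [cite: BourbakiAlgebre1a3, Ch. III §7 no. 1] -/
def Ulow (n : ℕ) (bV : Basis (Fin (n + n + (n + n))) K V) : Submodule K V :=
  Submodule.span K (Set.range (bV ∘ lowIdx n))

/-- `H¹ = U₊ ⊕ U₋`. [cite: BourbakiAlgebre1a3, Ch. II §1 no. 11] -/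
theorem isCompl_Uup_Ulow : IsCompl (Uup n bV) (Ulow n bV) := by
  refine ⟨?_, ?_⟩
  · rw [Uup, Ulow, Set.range_comp, Set.range_comp]
    exact bV.linearIndependent.disjoint_span_image disjoint_range_upIdx_lowIdx
  · rw [codisjoint_iff, Uup, Ulow, Set.range_comp, Set.range_comp, ← Submodule.span_union, ← Set.image_union,
      range_upIdx_union_lowIdx, Set.image_univ, bV.span_eq]

/-- `dim U₊ = 2n`. -/
theorem finrank_Uup : Module.finrank K (Uup n bV) = n + n := by
  rw [Uup, finrank_span_eq_card (bV.linearIndependent.comp _ upIdx_injective), Fintype.card_sum, Fintype.card_fin]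

/-- `dim U₋ = 2n`. -/
theorem finrank_Ulow : Module.finrank K (Ulow n bV) = n + n := by
  rw [Ulow, finrank_span_eq_card (bV.linearIndependent.comp _ lowIdx_injective), Fintype.card_sum, Fintype.card_fin]

/-- the upper half of `L`: `L₊ = ⟨ℓ_{n+j}⟩`. -/
def Lup (n : ℕ) (bV : Basis (Fin (n + n + (n + n))) K V) : Submodule K V :=
  Submodule.span K (Set.range fun j : Fin n => ℓ bV (Fin.natAdd n j))

/-- the lower half of `L`: `L₋ = ⟨ℓ_j⟩`. -/
def Llow (n : ℕ) (bV : Basis (Fin (n + n + (n + n))) K V) : Submodule K V :=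
  Submodule.span K (Set.range fun j : Fin n => ℓ bV (Fin.castAdd n j))

/-- `L₊ ⊆ U₊`. -/
theorem Lup_le_Uup : Lup n bV ≤ Uup n bV := by
  rw [Lup, Submodule.span_le]
  rintro _ ⟨j, rfl⟩
  exact Submodule.subset_span ⟨Sum.inl j, rfl⟩

/-- `L₋ ⊆ U₋`. -/
theorem Llow_le_Ulow : Llow n bV ≤ Ulow n bV := by
  rw [Llow, Submodule.span_le]
  rintro _ ⟨j, rfl⟩
  exact Submodule.subset_span ⟨Sum.inl j, rfl⟩

/-- `dim L₊ = n`. -/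
theorem finrank_Lup : Module.finrank K (Lup n bV) = n := by
  have hli : LinearIndependent K (fun j : Fin n => ℓ bV (Fin.natAdd n j)) :=
    bV.linearIndependent.comp (fun j => Fin.castAdd (n + n) (Fin.natAdd n j)) fun j j' h => by
      simpa [Fin.ext_iff] using h
  rw [Lup, finrank_span_eq_card hli, Fintype.card_fin]

/-- `dim L₋ = n`. -/
theorem finrank_Llow : Module.finrank K (Llow n bV) = n := by
  have hli : LinearIndependent K (fun j : Fin n => ℓ bV (Fin.castAdd n j)) :=
    bV.linearIndependent.comp (fun j => Fin.castAdd (n + n) (Fin.castAdd n j)) fun j j' h => by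
      simpa [Fin.ext_iff] using h
  rw [Llow, finrank_span_eq_card hli, Fintype.card_fin]

/-- `L = L₊ ⊕ L₋` (as a sup): the bridge's `Lsp bV = span ℓ` splits along the blocks. -/
theorem Lsp_eq_sup : Lsp bV = Lup n bV ⊔ Llow n bV := by
  rw [Lsp, Lup, Llow, ← Submodule.span_union]
  congr 1
  ext v
  simp only [Set.mem_range, Set.mem_union]
  constructor
  · rintro ⟨a, rfl⟩
    by_cases ha : (a : ℕ) < n
    · exact Or.inr ⟨⟨a, ha⟩, congrArg (ℓ bV) (Fin.ext rfl)⟩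
    · exact Or.inl ⟨⟨a - n, by omega⟩, congrArg (ℓ bV) (Fin.ext (show n + (a - n) = (a : ℕ) by omega))⟩
  · rintro (⟨j, rfl⟩ | ⟨j, rfl⟩)
    · exact ⟨_, rfl⟩
    · exact ⟨_, rfl⟩

/-! ### 2. The Weil vectors as top forms INSIDE the blocks (`ω₊ ∈ Λ^{2n} U₊`, `ω₋ ∈ Λ^{2n} U₋`) -/

/-- `ℓ_k ∈ U₊` for `n ≤ k < 2n`. -/
lemma ℓN_mem_Uup {k : ℕ} (hk : n ≤ k) (hkN : k < n + n) : ℓN bV k ∈ Uup n bV := by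
  refine Submodule.subset_span ⟨Sum.inl ⟨k - n, by omega⟩, ?_⟩
  rw [ℓN, dif_pos hkN, ℓ]
  simp only [Function.comp_apply, upIdx, Sum.elim_inl]
  congr 1; ext; simp; omega

/-- `m_k ∈ U₊` for `k < n`. -/
lemma mN_mem_Uup {k : ℕ} (hk : k < n) : mN bV k ∈ Uup n bV := by
  refine Submodule.subset_span ⟨Sum.inr ⟨k, hk⟩, ?_⟩
  rw [mN, dif_pos (by omega), m]
  simp only [Function.comp_apply, upIdx, Sum.elim_inr]
  congr 1

/-- `ℓ_k ∈ U₋` for `k < n`. -/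
lemma ℓN_mem_Ulow {k : ℕ} (hk : k < n) : ℓN bV k ∈ Ulow n bV := by
  refine Submodule.subset_span ⟨Sum.inl ⟨k, hk⟩, ?_⟩
  rw [ℓN, dif_pos (by omega), ℓ]
  simp only [Function.comp_apply, lowIdx, Sum.elim_inl]
  congr 1

/-- `m_k ∈ U₋` for `n ≤ k < 2n`. -/
lemma mN_mem_Ulow {k : ℕ} (hk : n ≤ k) (hkN : k < n + n) : mN bV k ∈ Ulow n bV := by
  refine Submodule.subset_span ⟨Sum.inr ⟨k - n, by omega⟩, ?_⟩
  rw [mN, dif_pos hkN, m]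
  simp only [Function.comp_apply, lowIdx, Sum.elim_inr]
  congr 1; ext; simp; omega

/-- `ℓ_k` as an element of `U₊` (junk `0` outside `n ≤ k < 2n`). -/
def ℓUp (k : ℕ) : Uup n bV := if h : n ≤ k ∧ k < n + n then ⟨ℓN bV k, ℓN_mem_Uup bV h.1 h.2⟩ else 0

/-- `m_k` as an element of `U₊` (junk `0` for `k ≥ n`). -/
def mUp (k : ℕ) : Uup n bV := if h : k < n then ⟨mN bV k, mN_mem_Uup bV h⟩ else 0

/-- `ℓ_k` as an element of `U₋` (junk `0` for `k ≥ n`). -/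
def ℓLow (k : ℕ) : Ulow n bV := if h : k < n then ⟨ℓN bV k, ℓN_mem_Ulow bV h⟩ else 0

/-- `m_k` as an element of `U₋` (junk `0` outside `n ≤ k < 2n`). -/
def mLow (k : ℕ) : Ulow n bV := if h : n ≤ k ∧ k < n + n then ⟨mN bV k, mN_mem_Ulow bV h.1 h.2⟩ else 0

/-- `ℓ_n ∧ ⋯ ∧ ℓ_{k-1}` inside `Λ U₊` (mirrors `ellprodFrom bV n`). -/
def ellprodUp : ℕ → ExteriorAlgebra K (Uup n bV)
  | 0 => 1
  | k + 1 => ellprodUp k * (if n ≤ k then ι K (ℓUp bV k) else 1)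

/-- `m_{k-1} ∧ ⋯ ∧ m_0` inside `Λ U₊` (mirrors `vac bV k`, used for `k ≤ n`). -/
def vacUp : ℕ → ExteriorAlgebra K (Uup n bV)
  | 0 => 1
  | k + 1 => ι K (mUp bV k) * vacUp k

/-- `ℓ_0 ∧ ⋯ ∧ ℓ_{k-1}` inside `Λ U₋` (mirrors `ellprod bV k`, used for `k ≤ n`). -/
def ellprodLow : ℕ → ExteriorAlgebra K (Ulow n bV)
  | 0 => 1
  | k + 1 => ellprodLow k * ι K (ℓLow bV k)

/-- `m_{k-1} ∧ ⋯ ∧ m_n` inside `Λ U₋` (mirrors `vacFrom bV n k`). -/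
def vacLow : ℕ → ExteriorAlgebra K (Ulow n bV)
  | 0 => 1
  | k + 1 => (if n ≤ k then ι K (mLow bV k) else 1) * vacLow k

/-- **`ω₊ ∈ Λ U₊`** with `Λ(ι_{U₊}) ω₊ = w₊`. [cite: BourbakiAlgebre1a3, Ch. III §7 no. 1] -/
def omegaUp : ExteriorAlgebra K (Uup n bV) := ellprodUp bV (n + n) * vacUp bV n

/-- **`ω₋ ∈ Λ U₋`** with `Λ(ι_{U₋}) ω₋ = w₋`. [cite: BourbakiAlgebre1a3, Ch. III §7 no. 1] -/
def omegaLow : ExteriorAlgebra K (Ulow n bV) := ellprodLow bV n * vacLow bV (n + n)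

/-- `Λ(ι_{U₊})(ℓ_n ∧ ⋯ ∧ ℓ_{k-1}) = ellprodFrom bV n k` for `k ≤ 2n`. -/
lemma map_ellprodUp : ∀ k : ℕ, k ≤ n + n →
    ExteriorAlgebra.map (Uup n bV).subtype (ellprodUp bV k) = ellprodFrom bV n k
  | 0, _ => by rw [ellprodUp, ellprodFrom, map_one]
  | k + 1, hk => by
    by_cases h : n ≤ k
    · rw [ellprodUp, ellprodFrom, if_pos h, if_pos h, map_mul, map_ellprodUp k (by omega), ExteriorAlgebra.map_apply_ι,
        ℓUp, dif_pos ⟨h, by omega⟩, Submodule.subtype_apply]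
    · rw [ellprodUp, ellprodFrom, if_neg h, if_neg h, mul_one, mul_one, map_ellprodUp k (by omega)]

/-- `Λ(ι_{U₊})(m_{k-1} ∧ ⋯ ∧ m_0) = vac bV k` for `k ≤ n`. -/
lemma map_vacUp : ∀ k : ℕ, k ≤ n → ExteriorAlgebra.map (Uup n bV).subtype (vacUp bV k) = vac bV k
  | 0, _ => by rw [vacUp, vac, map_one]
  | k + 1, hk => by
    rw [vacUp, vac, map_mul, map_vacUp k (by omega), ExteriorAlgebra.map_apply_ι, mUp, dif_pos (by omega),
      Submodule.subtype_apply]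

/-- `Λ(ι_{U₋})(ℓ_0 ∧ ⋯ ∧ ℓ_{k-1}) = ellprod bV k` for `k ≤ n`. -/
lemma map_ellprodLow : ∀ k : ℕ, k ≤ n → ExteriorAlgebra.map (Ulow n bV).subtype (ellprodLow bV k) = ellprod bV k
  | 0, _ => by rw [ellprodLow, ellprod, map_one]
  | k + 1, hk => by
    rw [ellprodLow, ellprod, map_mul, map_ellprodLow k (by omega), ExteriorAlgebra.map_apply_ι, ℓLow, dif_pos (by omega),
      Submodule.subtype_apply]

/-- `Λ(ι_{U₋})(m_{k-1} ∧ ⋯ ∧ m_n) = vacFrom bV n k` for `k ≤ 2n`. -/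
lemma map_vacLow : ∀ k : ℕ, k ≤ n + n → ExteriorAlgebra.map (Ulow n bV).subtype (vacLow bV k) = vacFrom bV n k
  | 0, _ => by rw [vacLow, vacFrom, map_one]
  | k + 1, hk => by
    by_cases h : n ≤ k
    · rw [vacLow, vacFrom, if_pos h, if_pos h, map_mul, map_vacLow k (by omega), ExteriorAlgebra.map_apply_ι, mLow,
        dif_pos ⟨h, by omega⟩, Submodule.subtype_apply]
    · rw [vacLow, vacFrom, if_neg h, if_neg h, one_mul, one_mul, map_vacLow k (by omega)]

/-- **`Λ(ι_{U₊}) ω₊ = w₊`.** -/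
theorem map_omegaUp : ExteriorAlgebra.map (Uup n bV).subtype (omegaUp bV) = wUp bV n := by
  rw [omegaUp, wUp, map_mul, map_ellprodUp bV (n + n) (le_refl _), map_vacUp bV n (le_refl _)]

/-- **`Λ(ι_{U₋}) ω₋ = w₋`.** -/
theorem map_omegaLow : ExteriorAlgebra.map (Ulow n bV).subtype (omegaLow bV) = wLow bV n := by
  rw [omegaLow, wLow, map_mul, map_ellprodLow bV n (le_refl _), map_vacLow bV (n + n) (le_refl _)]

/-- degree bookkeeping: a product with one more generator climbs one exterior power. -/
lemma mul_ι_mem_exteriorPower {W : Type*} [AddCommGroup W] [Module K W] {k : ℕ} {x : ExteriorAlgebra K W}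
    (hx : x ∈ ⋀[K]^k W) (w : W) : x * ι K w ∈ ⋀[K]^(k + 1) W := by
  rw [ExteriorAlgebra.exteriorPower, pow_succ]
  exact Submodule.mul_mem_mul hx (LinearMap.mem_range_self _ w)

/-- degree bookkeeping, generator on the left. -/
lemma ι_mul_mem_exteriorPower {W : Type*} [AddCommGroup W] [Module K W] {k : ℕ} {x : ExteriorAlgebra K W}
    (hx : x ∈ ⋀[K]^k W) (w : W) : ι K w * x ∈ ⋀[K]^(k + 1) W := by
  rw [ExteriorAlgebra.exteriorPower, pow_succ']
  exact Submodule.mul_mem_mul (LinearMap.mem_range_self _ w) hx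

/-- `ℓ_n ∧ ⋯ ∧ ℓ_{k-1} ∈ Λ^{k-n} U₊`. -/
lemma ellprodUp_mem : ∀ k : ℕ, ellprodUp bV k ∈ ⋀[K]^(k - n) (Uup n bV)
  | 0 => by rw [ellprodUp, Nat.zero_sub, ExteriorAlgebra.exteriorPower, pow_zero]; exact Submodule.algebraMap_mem 1
  | k + 1 => by
    by_cases h : n ≤ k
    · rw [ellprodUp, if_pos h, show k + 1 - n = (k - n) + 1 by omega]
      exact mul_ι_mem_exteriorPower (ellprodUp_mem k) _
    · rw [ellprodUp, if_neg h, mul_one, show k + 1 - n = k - n by omega]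
      exact ellprodUp_mem k

/-- `m_{k-1} ∧ ⋯ ∧ m_0 ∈ Λ^k U₊`. -/
lemma vacUp_mem : ∀ k : ℕ, vacUp bV k ∈ ⋀[K]^k (Uup n bV)
  | 0 => by rw [vacUp, ExteriorAlgebra.exteriorPower, pow_zero]; exact Submodule.algebraMap_mem 1
  | k + 1 => by rw [vacUp]; exact ι_mul_mem_exteriorPower (vacUp_mem k) _

/-- `ℓ_0 ∧ ⋯ ∧ ℓ_{k-1} ∈ Λ^k U₋`. -/
lemma ellprodLow_mem : ∀ k : ℕ, ellprodLow bV k ∈ ⋀[K]^k (Ulow n bV)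
  | 0 => by rw [ellprodLow, ExteriorAlgebra.exteriorPower, pow_zero]; exact Submodule.algebraMap_mem 1
  | k + 1 => by rw [ellprodLow]; exact mul_ι_mem_exteriorPower (ellprodLow_mem k) _

/-- `m_{k-1} ∧ ⋯ ∧ m_n ∈ Λ^{k-n} U₋`. -/
lemma vacLow_mem : ∀ k : ℕ, vacLow bV k ∈ ⋀[K]^(k - n) (Ulow n bV)
  | 0 => by rw [vacLow, Nat.zero_sub, ExteriorAlgebra.exteriorPower, pow_zero]; exact Submodule.algebraMap_mem 1
  | k + 1 => by
    by_cases h : n ≤ k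
    · rw [vacLow, if_pos h, show k + 1 - n = (k - n) + 1 by omega]
      exact ι_mul_mem_exteriorPower (vacLow_mem k) _
    · rw [vacLow, if_neg h, one_mul, show k + 1 - n = k - n by omega]
      exact vacLow_mem k

/-- **`ω₊ ∈ Λ^{2n} U₊`** (a top form of the block). -/
theorem omegaUp_mem : omegaUp bV ∈ ⋀[K]^(n + n) (Uup n bV) := by
  have h := Submodule.mul_mem_mul (ellprodUp_mem bV (n + n)) (vacUp_mem bV n)
  rw [ExteriorAlgebra.exteriorPower, ExteriorAlgebra.exteriorPower, ← pow_add, show n + n - n + n = n + n by omega] at h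
  exact h

/-- **`ω₋ ∈ Λ^{2n} U₋`.** -/
theorem omegaLow_mem : omegaLow bV ∈ ⋀[K]^(n + n) (Ulow n bV) := by
  have h := Submodule.mul_mem_mul (ellprodLow_mem bV n) (vacLow_mem bV (n + n))
  rw [ExteriorAlgebra.exteriorPower, ExteriorAlgebra.exteriorPower, ← pow_add, show n + (n + n - n) = n + n by omega] at h
  exact h

/-- `w₊ ≠ 0` (its bridge preimage maps under `Ψ` to a unit multiple of a basis monomial). -/
theorem wUp_ne_zero : wUp bV n ≠ 0 := by
  obtain ⟨c, hc, hΨ⟩ := Ψ_up bV n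
  intro h0
  have h1 : WedgeBridge.Φ K (Lsp bV) (vacuum bV) (xprodFrom bV n (n + n) * yprodFrom bV n (n + n)) = 0 := by
    rw [Φ_up bV (by omega), h0]
  have h2 : xprodFrom bV n (n + n) * yprodFrom bV n (n + n) = 0 :=
    Φ_vacuum_injective bV (by rw [h1, map_zero])
  have h3 := congrArg (Summit.Ventures.HSemireg.WedgeC15.Ψ bV) h2
  rw [hΨ, map_zero, smul_eq_zero] at h3
  exact h3.elim hc (Basis.ne_zero _ _)

/-- `w₋ ≠ 0`. -/
theorem wLow_ne_zero : wLow bV n ≠ 0 := by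
  obtain ⟨c, hc, hΨ⟩ := Ψ_low bV (p := n) (by omega)
  intro h0
  have h1 : WedgeBridge.Φ K (Lsp bV) (vacuum bV) (xprod bV n * yprod bV n) = 0 := by
    rw [Φ_low bV (by omega), h0, smul_zero]
  have h2 : xprod bV n * yprod bV n = 0 := Φ_vacuum_injective bV (by rw [h1, map_zero])
  have h3 := congrArg (Summit.Ventures.HSemireg.WedgeC15.Ψ bV) h2
  rw [hΨ, map_zero, smul_eq_zero] at h3
  exact h3.elim hc (Basis.ne_zero _ _)

/-- `ω₊ ≠ 0`. -/
theorem omegaUp_ne_zero : omegaUp bV ≠ 0 := fun h =>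
  wUp_ne_zero bV (by rw [← map_omegaUp, h, map_zero])

/-- `ω₋ ≠ 0`. -/
theorem omegaLow_ne_zero : omegaLow bV ≠ 0 := fun h =>
  wLow_ne_zero bV (by rw [← map_omegaLow, h, map_zero])

end WeilCarrier

end Summit.Ventures.HSemireg

end
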